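import Mathlib

/-!
# The family wall: `Σ_i |X_i||Y_i| ≤ dim J` for simultaneously `J`-separated families

Route `LevelGradedCohnUmans`, crux `GradedDesignFamily` (stmt-MatrixMultiplication-7610), line `Sketch`
(card `graded-stpp-wreath`, "second lemma", in the form corrected by TRIAGE-r1-2: every `Z_i` must be
non-empty — `simWallAsStated_false` otherwise).  For a RIGHT-translation-invariant `J ≤ ℂ^G` and a
family `(X_i, Y_i, Z_i)_i` simultaneously `J`-separated in the line's 0/1 pattern, the evaluation
functionals `f ↦ f(x⁻¹ y)`, `x ∈ X_i`, `y ∈ Y_i`, are linearly independent on `J` ACROSS ALL BLOCKS: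
test a relation against the right translate `g ↦ f_{b,x₀,z₀}(g · y'⁻¹ z₀)` of the separator of block
`b`; cross-block terms are mixed quadruple products and vanish by simultaneity.  Hence
`Σ_i |X_i||Y_i| ≤ dim J* = dim J` (`familyWall_card_le_finrank`): the pieces of a family SHARE the
wall `D = dim J` — the accounting on which the line's `stub_shareUniversality` is built.
[cite: CohnKleinbergSzegedyUmans2005, Def. 5.1]
-/

noncomputable section

set_option linter.dupNamespace false

open scoped BigOperators
open Module

namespace Summit.MatrixMultiplication.MatrixMultiplication.Theorems.GradedDesignFamily

/-- **The family wall.**  If `J ≤ ℂ^G` is right-translation invariant and the family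
`(X_i, Y_i, Z_i)_{i : ι}` with all `Z_i` non-empty is simultaneously `J`-separated, then
`Σ_i |X_i|·|Y_i| ≤ dim J`. [cite: CohnKleinbergSzegedyUmans2005, Def. 5.1] -/
theorem familyWall_card_le_finrank {G : Type} [Group G] [Fintype G] {ι : Type} [Fintype ι]
    [DecidableEq ι] (J : Submodule ℂ (G → ℂ)) (hJ : ∀ f ∈ J, ∀ u : G, (fun g : G => f (g * u)) ∈ J)
    (X Y Z : ι → Finset G) (hZ : ∀ i, (Z i).Nonempty)
    (hsep : ∀ i : ι, ∀ x₀ ∈ X i, ∀ z₀ ∈ Z i, ∃ f ∈ J, ∀ a b : ι, ∀ x ∈ X a, ∀ y ∈ Y a, ∀ y' ∈ Y b,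
      ∀ z ∈ Z b, ((a = i ∧ b = i ∧ x = x₀ ∧ y = y' ∧ z = z₀) → f (x⁻¹ * y * y'⁻¹ * z) = 1) ∧
        (¬ (a = i ∧ b = i ∧ x = x₀ ∧ y = y' ∧ z = z₀) → f (x⁻¹ * y * y'⁻¹ * z) = 0)) :
    ∑ i, (X i).card * (Y i).card ≤ finrank ℂ J := by
  classical
  -- index set: pairs `(x, y) ∈ X_i × Y_i` over all blocks `i`
  let S : Type := Σ i : ι, ↥(X i ×ˢ Y i)
  -- evaluation functionals on `J` at the points `x⁻¹ y`
  let v : S → Module.Dual ℂ J := fun s =>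
    (LinearMap.proj ((s.2 : G × G).1⁻¹ * (s.2 : G × G).2) : (G → ℂ) →ₗ[ℂ] ℂ).comp J.subtype
  have hv : ∀ (s : S) (f : J), v s f = (f : G → ℂ) ((s.2 : G × G).1⁻¹ * (s.2 : G × G).2) :=
    fun s f => rfl
  have hlin : LinearIndependent ℂ v := by
    rw [linearIndependent_iff']
    intro T c hrel s₀ hs₀
    obtain ⟨b, ⟨⟨x₀, y'⟩, hp⟩⟩ := s₀
    obtain ⟨hx₀, hy'⟩ := Finset.mem_product.mp hp
    obtain ⟨z₀, hz₀⟩ := hZ b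
    obtain ⟨f, hfJ, hf⟩ := hsep b x₀ hx₀ z₀ hz₀
    -- right translate of the separator by `u = y'⁻¹ z₀`
    have hf' : (fun g : G => f (g * (y'⁻¹ * z₀))) ∈ J := hJ f hfJ (y'⁻¹ * z₀)
    have key := congrArg (fun φ : Module.Dual ℂ J => φ ⟨_, hf'⟩) hrel
    simp only [LinearMap.coe_sum, Finset.sum_apply, LinearMap.smul_apply, LinearMap.zero_apply,
      smul_eq_mul, hv] at key
    -- every term is `c s · [s = s₀]`
    have hterm : ∀ s ∈ T, c s * f ((s.2 : G × G).1⁻¹ * (s.2 : G × G).2 * (y'⁻¹ * z₀)) =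
        if s = ⟨b, ⟨(x₀, y'), hp⟩⟩ then c s else 0 := by
      rintro ⟨a, ⟨⟨x, y⟩, hq⟩⟩ -
      obtain ⟨hx, hy⟩ := Finset.mem_product.mp hq
      obtain ⟨h1, h0⟩ := hf a b x hx y hy y' hy' z₀ hz₀
      have hassoc : x⁻¹ * y * (y'⁻¹ * z₀) = x⁻¹ * y * y'⁻¹ * z₀ := by group
      simp only [hassoc]
      by_cases hs : (⟨a, ⟨(x, y), hq⟩⟩ : S) = ⟨b, ⟨(x₀, y'), hp⟩⟩
      · rw [if_pos hs]
        have h := Sigma.mk.inj_iff.mp hs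
        obtain ⟨rfl, h2⟩ := h
        have h2' := Subtype.ext_iff.mp (eq_of_heq h2)
        simp only [Prod.mk.injEq] at h2'
        obtain ⟨rfl, rfl⟩ := h2'
        rw [h1 ⟨rfl, rfl, rfl, rfl, rfl⟩, mul_one]
      · rw [if_neg hs, h0, mul_zero]
        rintro ⟨rfl, -, rfl, rfl, -⟩
        exact hs rfl
    rw [Finset.sum_congr rfl hterm, Finset.sum_ite_eq' T, if_pos hs₀] at key
    exact key
  have hcard : Fintype.card S = ∑ i, (X i).card * (Y i).card := by
    simp only [S, Fintype.card_sigma, Fintype.card_coe, Finset.card_product]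
  haveI : FiniteDimensional ℂ J := inferInstance
  calc ∑ i, (X i).card * (Y i).card = Fintype.card S := hcard.symm
    _ ≤ finrank ℂ (Module.Dual ℂ J) := hlin.fintype_card_le_finrank
    _ = finrank ℂ J := Subspace.dual_finrank_eq

end Summit.MatrixMultiplication.MatrixMultiplication.Theorems.GradedDesignFamily

end
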